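import Mathlib.MeasureTheory.Integral.IntegralEqImproper
import Mathlib.Analysis.Calculus.Deriv.MeanValue
import Literature.Analysis.FluidPDE.StretchedLayerNS
import HarnessLib

/-!
# The Burgers shear layer as a member of the stretched-layer Navier–Stokes class

Analysis/FluidPDE file, everything proved (no definition, no named fact). The file
`StretchedLayerNS.lean` introduces the class `IsStretchedLayerNSSolutionOn S ν γ ΔU L u v p` of classical
solutions of the stretched two-dimensional Navier–Stokes system of a strained shear layer and the
time-dependent field `burgersShearLayer γ ν ΔU : (t, x, y) ↦ U_B(y)`, `U_B = burgersLayerProfile γ ν ΔU`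
(Majda–Bertozzi 2002, §1.4, Example 1.8, eq. (1.48)), and announces the present file. Here we prove:

* derivative bookkeeping of the profile (`deriv U_B = burgersLayerProfileD`, `deriv U_B' = burgersLayerProfileDD`),
  the slice derivatives of `burgersShearLayer` (`∂ₓ = 0`, `∂_y = U_B'`, `∂_y∂_y = U_B''`, `∂ₜ = 0`);
* the GAUSSIAN-PRIMITIVE FORM `U_B(y) = (ΔU/√π) κ ∫₀^y e^{−γs²/(2ν)} ds`, `κ = (γ/2ν)^{1/2}`, and its `γ = 1`
  specialisation `U_B(y) = ΔU (2πν)^{-1/2} ∫₀^y e^{−s²/(2ν)} ds` (the form in which strained-layer statements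
  inline the datum);
* MEMBERSHIP: for `γ, ν > 0` the triple `(burgersShearLayer γ ν ΔU, 0, c)` is an
  `IsStretchedLayerNSSolutionOn S ν γ ΔU L` for every time set `S`, period `L` and constant pressure `c`
  (`νU_B'' = −γyU_B'`, everything else vanishes; far field `±ΔU/2`);
* DISSIPATION: `layerDissipation ν L (U_B) 0 = ofReal (ΔU² (γν)^{1/2}/(2√π))` for `L > 0` — the laminar
  (Sweet–Parker) rung `ΔU²(νγ/4π)^{1/2}`, from `burgersLayer_dissipation`;
* the profile is monotone with `|U_B| ≤ ΔU/2`, `U_B'` is integrable and `∫ U_B' = ΔU` (the jump).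

The Gaussian TAILS of `U_B ∓ ΔU/2`, `U_B'`, `U_B''` in exponential dress and the shear-layer tails side
condition `HasShearLayerTails (burgersShearLayer γ ν 1) 0` are the companion file
`StretchedLayerNSBurgersTails.lean`. Deliberately NOT here: stability of the layer, the Mehler (strained heat)
flow of `x`-independent data, anything dynamical.

References: Majda–Bertozzi 2002 §1.4 Ex. 1.8 (1.48); Burgers 1948; Beronov–Kida 1996 §II (the base flow).
-/

noncomputable section

open Set Function Filter
open _root_.MeasureTheory _root_.Topology
open scoped ENNReal

namespace Literature.Analysis.FluidPDE

open StretchedLayer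

/-! ### Derivative bookkeeping -/

/-- `U_B' = burgersLayerProfileD` as functions (`hasDerivAt_burgersLayerProfile'`). [folklore] -/
theorem deriv_burgersLayerProfile_eq_D (γ ν ΔU : ℝ) :
    deriv (burgersLayerProfile γ ν ΔU) = burgersLayerProfileD γ ν ΔU :=
  funext fun s => (hasDerivAt_burgersLayerProfile' γ ν ΔU s).deriv

/-- `U_B'' = burgersLayerProfileDD` as functions (`hasDerivAt_burgersLayerProfileD`). [folklore] -/
theorem deriv_burgersLayerProfileD_eq_DD (γ ν ΔU : ℝ) :
    deriv (burgersLayerProfileD γ ν ΔU) = burgersLayerProfileDD γ ν ΔU :=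
  funext fun s => (hasDerivAt_burgersLayerProfileD γ ν ΔU s).deriv

/-- The Burgers shear layer has no `x`-derivative. [folklore] -/
@[simp] theorem dX_burgersShearLayer (γ ν ΔU t : ℝ) : dX (burgersShearLayer γ ν ΔU t) = 0 := by
  funext x y; simp [dX]

/-- The `y`-derivative of the Burgers shear layer is `U_B'`. [folklore] -/
@[simp] theorem dY_burgersShearLayer (γ ν ΔU t : ℝ) :
    dY (burgersShearLayer γ ν ΔU t) = fun _ y => burgersLayerProfileD γ ν ΔU y := by
  funext x y
  simp only [dY, burgersShearLayer_apply]
  exact (hasDerivAt_burgersLayerProfile' γ ν ΔU y).deriv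

/-- The second `y`-derivative of the Burgers shear layer is `U_B''`. [folklore] -/
@[simp] theorem dY_dY_burgersShearLayer (γ ν ΔU t : ℝ) :
    dY (dY (burgersShearLayer γ ν ΔU t)) = fun _ y => burgersLayerProfileDD γ ν ΔU y := by
  rw [dY_burgersShearLayer]
  funext x y
  simp only [dY]
  exact (hasDerivAt_burgersLayerProfileD γ ν ΔU y).deriv

/-- The Laplacian of the Burgers shear layer is `U_B''`. [folklore] -/
@[simp] theorem lap_burgersShearLayer (γ ν ΔU t x y : ℝ) :
    lap (burgersShearLayer γ ν ΔU t) x y = burgersLayerProfileDD γ ν ΔU y := by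
  rw [lap_apply, dY_dY_burgersShearLayer, dX_burgersShearLayer, dX_zero]
  simp

/-- The Burgers shear layer is steady: its one-sided time derivative vanishes within any time set. [folklore] -/
@[simp] theorem dT_burgersShearLayer (S : Set ℝ) (γ ν ΔU t x y : ℝ) :
    dT S (burgersShearLayer γ ν ΔU) t x y = 0 := by
  simp [dT]

/-- The Burgers shear layer is steady: time lines are constant. [folklore] -/
@[simp] theorem deriv_time_burgersShearLayer (γ ν ΔU t x y : ℝ) :
    deriv (fun s => burgersShearLayer γ ν ΔU s x y) t = 0 := by
  simp

/-! ### The Gaussian-primitive form of the profile -/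

/-- **Gaussian-primitive form of the Burgers layer profile**: for `γ/(2ν) ≥ 0`,
`U_B(y) = (ΔU/√π) κ ∫₀^y e^{−(γ/2ν)s²} ds`, `κ = (γ/2ν)^{1/2}` (substitute `t = κ s` in
`(ΔU/√π)∫₀^{κy} e^{−t²} dt`). [cite: MajdaBertozzi2002, §1.4 Example 1.8 eq. (1.48)] -/
theorem burgersLayerProfile_eq_gaussian_primitive {γ ν : ℝ} (h : 0 ≤ γ / (2 * ν)) (ΔU y : ℝ) :
    burgersLayerProfile γ ν ΔU y =
      ΔU / Real.sqrt Real.pi * burgersLayerRate γ ν *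
        ∫ s in (0:ℝ)..y, Real.exp (-(γ / (2 * ν) * s ^ 2)) := by
  set κ := burgersLayerRate γ ν with hκdef
  have hκ2 : κ ^ 2 = γ / (2 * ν) := burgersLayerRate_sq h
  have h1 : ∫ t in (0:ℝ)..(κ * y), Real.exp (-t ^ 2) =
      κ * ∫ s in (0:ℝ)..y, Real.exp (-(γ / (2 * ν) * s ^ 2)) := by
    have hh := intervalIntegral.smul_integral_comp_mul_left (fun t : ℝ => Real.exp (-t ^ 2)) κ
      (a := (0:ℝ)) (b := y)
    simp only [mul_zero, smul_eq_mul] at hh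
    rw [← hh]
    congr 1
    refine intervalIntegral.integral_congr fun s _ => ?_
    show Real.exp (-(κ * s) ^ 2) = Real.exp (-(γ / (2 * ν) * s ^ 2))
    rw [mul_pow, hκ2]
  unfold burgersLayerProfile
  rw [h1]
  ring

/-- **The `γ = 1` layer in the strained-layer statements' normalisation**: for `ν > 0`,
`burgersLayerProfile 1 ν ΔU y = ΔU · (2πν)^{-1/2} ∫₀^y e^{−s²/(2ν)} ds`. [folklore] -/
theorem burgersLayerProfile_one_eq {ν : ℝ} (hν : 0 < ν) (ΔU y : ℝ) :
    burgersLayerProfile 1 ν ΔU y =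
      ΔU * ((Real.sqrt (2 * Real.pi * ν))⁻¹ * ∫ s in (0:ℝ)..y, Real.exp (-(s ^ 2) / (2 * ν))) := by
  have h : 0 ≤ 1 / (2 * ν) := by positivity
  rw [burgersLayerProfile_eq_gaussian_primitive h]
  have hI : ∫ s in (0:ℝ)..y, Real.exp (-(1 / (2 * ν) * s ^ 2)) =
      ∫ s in (0:ℝ)..y, Real.exp (-(s ^ 2) / (2 * ν)) := by
    refine intervalIntegral.integral_congr fun s _ => ?_
    show Real.exp (-(1 / (2 * ν) * s ^ 2)) = Real.exp (-(s ^ 2) / (2 * ν))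
    congr 1
    field_simp
  rw [hI]
  have hκ : burgersLayerRate 1 ν = (Real.sqrt (2 * ν))⁻¹ := by
    rw [burgersLayerRate, Real.sqrt_div' _ (by positivity : (0:ℝ) ≤ 2 * ν)]
    simp
  rw [hκ, show (2 * Real.pi * ν) = Real.pi * (2 * ν) by ring, Real.sqrt_mul Real.pi_pos.le]
  have hπ : Real.sqrt Real.pi ≠ 0 := (Real.sqrt_pos.2 Real.pi_pos).ne'
  have h2ν : Real.sqrt (2 * ν) ≠ 0 := (Real.sqrt_pos.2 (by positivity)).ne'
  field_simp

/-! ### Membership in the class and the laminar dissipation -/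

/-- The profile is `C²` (indeed smooth). [folklore] -/
theorem contDiff_two_burgersLayerProfile (γ ν ΔU : ℝ) : ContDiff ℝ 2 (burgersLayerProfile γ ν ΔU) :=
  contDiff_infty.1 (contDiff_burgersLayerProfile γ ν ΔU) 2

/-- The Burgers shear layer is `C²` jointly in `(t, x, y)` (it depends on `y` only). [folklore] -/
theorem contDiff_burgersShearLayer (γ ν ΔU : ℝ) :
    ContDiff ℝ 2 (fun q : ℝ × ℝ × ℝ => burgersShearLayer γ ν ΔU q.1 q.2.1 q.2.2) :=
  (contDiff_two_burgersLayerProfile γ ν ΔU).comp (contDiff_snd.comp contDiff_snd)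

/-- **The Burgers shear layer solves the stretched system** (`γ, ν > 0`): with `v = 0` and any constant
pressure `c`, `(burgersShearLayer γ ν ΔU, 0, c)` is an `IsStretchedLayerNSSolutionOn S ν γ ΔU L` for
every time set `S` and every period `L` — the `x`-momentum balance is `−γyU_B' = νU_B''`
(`burgersLayerProfile_ode`), the other equations vanish identically, the far field is `±ΔU/2`.
[cite: MajdaBertozzi2002, §1.4 Example 1.8 eq. (1.48)] -/
theorem isStretchedLayerNSSolutionOn_burgersShearLayer {γ ν : ℝ} (hγ : 0 < γ) (hν : 0 < ν)
    (ΔU L c : ℝ) (S : Set ℝ) :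
    IsStretchedLayerNSSolutionOn S ν γ ΔU L (burgersShearLayer γ ν ΔU) (fun _ _ _ => 0)
      (fun _ _ _ => c) where
  contDiffOn_u := (contDiff_burgersShearLayer γ ν ΔU).contDiffOn
  contDiffOn_v := contDiffOn_const
  contDiffOn_p := contDiffOn_const
  momentum_x t _ x y := by
    have hode := burgersLayerProfile_ode γ ν ΔU y
    simp only [dT_burgersShearLayer, dX_burgersShearLayer, dY_burgersShearLayer, lap_burgersShearLayer,
      Pi.zero_apply, mul_zero, add_zero, zero_add, zero_sub, dX_const, neg_zero]
    linarith
  momentum_y t _ x y := by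
    simp [dT, dX, dY, lap]
  divFree t _ x y := by simp
  periodic_u _ _ _ _ := rfl
  periodic_v _ _ _ _ := rfl
  periodic_p _ _ _ _ := rfl
  tendsto_u_atTop _ _ _ := tendsto_burgersLayerProfile_atTop hγ hν ΔU
  tendsto_u_atBot _ _ _ := tendsto_burgersLayerProfile_atBot hγ hν ΔU
  tendsto_v_atTop _ _ _ := tendsto_const_nhds
  tendsto_v_atBot _ _ _ := tendsto_const_nhds

/-- `(U_B')²` is the Gaussian `(ΔU²/π)(γ/2ν) e^{−(γ/ν)s²}` (for `γ/(2ν) ≥ 0`). [folklore] -/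
theorem burgersLayerProfileD_sq {γ ν : ℝ} (h : 0 ≤ γ / (2 * ν)) (ΔU s : ℝ) :
    burgersLayerProfileD γ ν ΔU s ^ 2 = ΔU ^ 2 / Real.pi * (γ / (2 * ν)) * Real.exp (-(γ / ν) * s ^ 2) := by
  rw [← deriv_burgersLayerProfile_eq_D]
  exact deriv_burgersLayerProfile_sq h ΔU s

/-- `(U_B')²` is integrable on `ℝ` (`γ, ν > 0`). [folklore] -/
theorem integrable_burgersLayerProfileD_sq {γ ν : ℝ} (hγ : 0 < γ) (hν : 0 < ν) (ΔU : ℝ) :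
    Integrable fun s => burgersLayerProfileD γ ν ΔU s ^ 2 := by
  have h : 0 ≤ γ / (2 * ν) := by positivity
  simp_rw [burgersLayerProfileD_sq h]
  exact (integrable_exp_neg_mul_sq (by positivity : 0 < γ / ν)).const_mul _

/-- `ν ∫ (U_B')² = ΔU² (γν)^{1/2}/(2√π)` (`burgersLayer_dissipation`, restated for the named derivative). [folklore] -/
theorem nu_mul_integral_burgersLayerProfileD_sq {γ ν : ℝ} (hγ : 0 < γ) (hν : 0 < ν) (ΔU : ℝ) :
    ν * ∫ s, burgersLayerProfileD γ ν ΔU s ^ 2 = ΔU ^ 2 * Real.sqrt (γ * ν) / (2 * Real.sqrt Real.pi) := by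
  rw [← deriv_burgersLayerProfile_eq_D]
  exact burgersLayer_dissipation hγ hν ΔU

/-- **Laminar dissipation per unit area**: for `γ, ν, L > 0` and every `t`,
`layerDissipation ν L (burgersShearLayer γ ν ΔU t) 0 = ofReal (ΔU² (γν)^{1/2}/(2√π))` — the Sweet–Parker
rung `ΔU²(νγ/4π)^{1/2}`, independent of `L`. [cite: MajdaBertozzi2002, §1.4 Example 1.8 eq. (1.48)] -/
theorem layerDissipation_burgersShearLayer {γ ν L : ℝ} (hγ : 0 < γ) (hν : 0 < ν) (hL : 0 < L) (ΔU t : ℝ) :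
    layerDissipation ν L (burgersShearLayer γ ν ΔU t) (fun _ _ => 0) =
      ENNReal.ofReal (ΔU ^ 2 * Real.sqrt (γ * ν) / (2 * Real.sqrt Real.pi)) := by
  have hJ : 0 ≤ ∫ s, burgersLayerProfileD γ ν ΔU s ^ 2 := integral_nonneg fun s => sq_nonneg _
  have hlin : ∫⁻ s, ENNReal.ofReal (burgersLayerProfileD γ ν ΔU s ^ 2) =
      ENNReal.ofReal (∫ s, burgersLayerProfileD γ ν ΔU s ^ 2) :=
    (ofReal_integral_eq_lintegral_ofReal (integrable_burgersLayerProfileD_sq hγ hν ΔU)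
      (Eventually.of_forall fun _ => sq_nonneg _)).symm
  rw [layerDissipation_def]
  simp only [dX_burgersShearLayer, dY_burgersShearLayer, Pi.zero_apply, dX_const, dY_const, ne_eq,
    OfNat.ofNat_ne_zero, not_false_eq_true, zero_pow, add_zero, zero_add]
  rw [hlin, setLIntegral_const, Real.volume_Ioc, sub_zero, ← ENNReal.ofReal_mul hJ,
    ← ENNReal.ofReal_mul (div_nonneg hν.le hL.le)]
  congr 1
  rw [show ν / L * ((∫ s, burgersLayerProfileD γ ν ΔU s ^ 2) * L) =
      ν * ∫ s, burgersLayerProfileD γ ν ΔU s ^ 2 by field_simp]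
  exact nu_mul_integral_burgersLayerProfileD_sq hγ hν ΔU

/-! ### Monotonicity, range and total jump of the profile -/

/-- `U_B' ≥ 0` for `ΔU ≥ 0`. [folklore] -/
theorem burgersLayerProfileD_nonneg (γ ν : ℝ) {ΔU : ℝ} (hΔU : 0 ≤ ΔU) (s : ℝ) :
    0 ≤ burgersLayerProfileD γ ν ΔU s := by
  unfold burgersLayerProfileD
  have hκ : 0 ≤ burgersLayerRate γ ν := Real.sqrt_nonneg _
  positivity

/-- `U_B' > 0` for `γ, ν, ΔU > 0`. [folklore] -/
theorem burgersLayerProfileD_pos {γ ν ΔU : ℝ} (hγ : 0 < γ) (hν : 0 < ν) (hΔU : 0 < ΔU) (s : ℝ) :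
    0 < burgersLayerProfileD γ ν ΔU s := by
  unfold burgersLayerProfileD
  have hκ : 0 < burgersLayerRate γ ν := burgersLayerRate_pos hγ hν
  positivity

/-- The profile is monotone for `ΔU ≥ 0`. [folklore] -/
theorem monotone_burgersLayerProfile (γ ν : ℝ) {ΔU : ℝ} (hΔU : 0 ≤ ΔU) :
    Monotone (burgersLayerProfile γ ν ΔU) :=
  monotone_of_deriv_nonneg (differentiable_burgersLayerProfile γ ν ΔU) fun s => by
    rw [deriv_burgersLayerProfile_eq_D]; exact burgersLayerProfileD_nonneg γ ν hΔU s

/-- `U_B ≤ ΔU/2` (`γ, ν > 0`, `ΔU ≥ 0`). [folklore] -/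
theorem burgersLayerProfile_le_half {γ ν ΔU : ℝ} (hγ : 0 < γ) (hν : 0 < ν) (hΔU : 0 ≤ ΔU) (s : ℝ) :
    burgersLayerProfile γ ν ΔU s ≤ ΔU / 2 :=
  (monotone_burgersLayerProfile γ ν hΔU).ge_of_tendsto (tendsto_burgersLayerProfile_atTop hγ hν ΔU) s

/-- `−ΔU/2 ≤ U_B` (`γ, ν > 0`, `ΔU ≥ 0`). [folklore] -/
theorem neg_half_le_burgersLayerProfile {γ ν ΔU : ℝ} (hγ : 0 < γ) (hν : 0 < ν) (hΔU : 0 ≤ ΔU) (s : ℝ) :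
    -(ΔU / 2) ≤ burgersLayerProfile γ ν ΔU s :=
  (monotone_burgersLayerProfile γ ν hΔU).le_of_tendsto (tendsto_burgersLayerProfile_atBot hγ hν ΔU) s

/-- `|U_B| ≤ ΔU/2` (`γ, ν > 0`, `ΔU ≥ 0`). [folklore] -/
theorem abs_burgersLayerProfile_le {γ ν ΔU : ℝ} (hγ : 0 < γ) (hν : 0 < ν) (hΔU : 0 ≤ ΔU) (s : ℝ) :
    |burgersLayerProfile γ ν ΔU s| ≤ ΔU / 2 :=
  abs_le.2 ⟨neg_half_le_burgersLayerProfile hγ hν hΔU s, burgersLayerProfile_le_half hγ hν hΔU s⟩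

/-- `U_B' ≤ (ΔU/√π) κ` for `ΔU ≥ 0` (the Gaussian factor is `≤ 1`). [folklore] -/
theorem burgersLayerProfileD_le {γ ν ΔU : ℝ} (hΔU : 0 ≤ ΔU) (s : ℝ) :
    burgersLayerProfileD γ ν ΔU s ≤ ΔU / Real.sqrt Real.pi * burgersLayerRate γ ν := by
  unfold burgersLayerProfileD
  have hκ : 0 ≤ burgersLayerRate γ ν := Real.sqrt_nonneg _
  have hc : 0 ≤ ΔU / Real.sqrt Real.pi * burgersLayerRate γ ν := by positivity
  have he : Real.exp (-(burgersLayerRate γ ν * s) ^ 2) ≤ 1 :=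
    Real.exp_le_one_iff.2 (neg_nonpos.2 (sq_nonneg _))
  calc ΔU / Real.sqrt Real.pi * (burgersLayerRate γ ν * Real.exp (-(burgersLayerRate γ ν * s) ^ 2))
      = ΔU / Real.sqrt Real.pi * burgersLayerRate γ ν * Real.exp (-(burgersLayerRate γ ν * s) ^ 2) := by
        ring
    _ ≤ ΔU / Real.sqrt Real.pi * burgersLayerRate γ ν * 1 := mul_le_mul_of_nonneg_left he hc
    _ = ΔU / Real.sqrt Real.pi * burgersLayerRate γ ν := mul_one _

/-- `U_B'` is integrable on `ℝ` (a Gaussian). [folklore] -/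
theorem integrable_burgersLayerProfileD {γ ν : ℝ} (hγ : 0 < γ) (hν : 0 < ν) (ΔU : ℝ) :
    Integrable (burgersLayerProfileD γ ν ΔU) := by
  have hκ2 : 0 < burgersLayerRate γ ν ^ 2 := pow_pos (burgersLayerRate_pos hγ hν) 2
  have h := (integrable_exp_neg_mul_sq hκ2).const_mul (ΔU / Real.sqrt Real.pi * burgersLayerRate γ ν)
  refine h.congr (Eventually.of_forall fun s => ?_)
  show ΔU / Real.sqrt Real.pi * burgersLayerRate γ ν * Real.exp (-(burgersLayerRate γ ν ^ 2) * s ^ 2) =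
    burgersLayerProfileD γ ν ΔU s
  unfold burgersLayerProfileD
  rw [show -(burgersLayerRate γ ν ^ 2) * s ^ 2 = -(burgersLayerRate γ ν * s) ^ 2 by ring]
  ring

/-- **Total jump**: `∫_ℝ U_B' = ΔU` (`γ, ν > 0`). [folklore] -/
theorem integral_burgersLayerProfileD {γ ν : ℝ} (hγ : 0 < γ) (hν : 0 < ν) (ΔU : ℝ) :
    ∫ s, burgersLayerProfileD γ ν ΔU s = ΔU := by
  have h := integral_of_hasDerivAt_of_tendsto (fun s => hasDerivAt_burgersLayerProfile' γ ν ΔU s)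
    (integrable_burgersLayerProfileD hγ hν ΔU) (tendsto_burgersLayerProfile_atBot hγ hν ΔU)
    (tendsto_burgersLayerProfile_atTop hγ hν ΔU)
  rw [h]; ring

end Literature.Analysis.FluidPDE

end
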